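import Summits.KontsevichZagierPeriods.Zeta5Search.Certificates.RecordRayDenominatorsLawW
import HarnessLib

/-!
# ζ(5) search — the record ray's DENOMINATORS, VIII-b: the four `(WV)`-law window lemmas `wLaw0–3` on `(12n, 16n]` (TYPER g15)

HONEST FRAMING: systematic search; no irrationality claim unless certified.

OUR work (Summit side; typer seat, generation 15).  See file VIII (`RecordRayDenominatorsLawW`) for the table; each lemma pins
`⌊cn/p⌋` (`c = 12,…,16`) on its window, evaluates `v_p(N♯(b)) = v_p(N♯(b′))`, bounds `a_p ≥ t`, `N_p ≤ f` at `b` and `b′`,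
applies the proved window laws `(WV)` (and `(V)` on `(15n,16n]`) and concludes with `dvd_zterm` + `law_core`.
Valuation bookkeeping only.
-/

noncomputable section

open Finset

namespace Summit.KontsevichZagierPeriods.Zeta5Search.RecordRay

open Summit.KontsevichZagierPeriods.Zeta5Search.DualSeries
open Summit.KontsevichZagierPeriods.Zeta5Search.DualSeriesDenominators
open Summit.KontsevichZagierPeriods.Zeta5Search.WedgeDictionary
open Summit.KontsevichZagierPeriods.Zeta5Search.DualSeriesLemma19 (bRecord)
open Summit.KontsevichZagierPeriods.Zeta5Search.CasoratianValuation (InPolytope pairFloors bMin topPartners refundW)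
open Summit.KontsevichZagierPeriods.Zeta5Search.ClusterValuation (lawW zeta3CoefficientValuationLaw_window
  constantTermFloorLaw_window)

section Windows

variable {n p : ℕ}

/-- (WV)-law window `(12n, 13n]`: `v_p(N♯) = 3`, `a_p ≥ 6`, `N_p ≤ 12`, so `v_p(W) ≥ -5` (Theorem `(WV)` in the window),
`v_p(z_W) ≥ 1`; exponent `1`. -/
theorem wLaw0 {n p : ℕ} (hn : 42 ≤ n) (hp : p.Prime) (hlo : 12 * n < p) (hhi : p ≤ 13 * n)
    {zW zV zW' zV' zU zU' : ℤ}
    (hzW : dRec n ^ 3 * sharpNormaliser (bRecord n) * coeffW (bRecord n) = zW)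
    (_hzV : dRec n ^ 6 * sharpNormaliser (bRecord n) * coeffV (bRecord n) = zV)
    (hzW' : dRec n ^ 3 * sharpNormaliser (bRecord' n) * coeffW (bRecord' n) = zW')
    (_hzV' : dRec n ^ 6 * sharpNormaliser (bRecord' n) * coeffV (bRecord' n) = zV')
    (_hzU : dRec n * sharpNormaliser (bRecord n) * coeffU (bRecord n) = zU)
    (_hzU' : dRec n * sharpNormaliser (bRecord' n) * coeffU (bRecord' n) = zU') :
    (p : ℤ) ^ 1 ∣ (zW' * zV - zW * zV') ∧
    (p : ℤ) ^ 1 ∣ ((Nat.lcmUpto (41 * n) : ℤ) ^ 5 * (zU * zW') - (Nat.lcmUpto (41 * n) : ℤ) ^ 5 * (zU' * zW)) := by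
  haveI := Fact.mk hp
  obtain ⟨h0, h1, h2, h3, h4, h5, h6, h7⟩ := bRecord_vals n
  obtain ⟨h0', h1', h2', h3', h4', h5', h6', h7'⟩ := bRecord'_vals n
  have hn1 : 1 ≤ n := by omega
  have hnp : n < p := by omega
  have hp5 : 5 ≤ p := by omega
  have hp41 : p ≤ 41 * n := by omega
  have hsq : 41 * n < p ^ 2 := by nlinarith
  have hsq16 : 16 * n < p ^ 2 := by nlinarith
  have hP := inPolytope_bRecord n
  have hP' := inPolytope_bRecord' hn1
  have hwin : (bRecord n 0 + 2 : ℤ) < (p : ℤ) ^ 2 := by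
    rw [h0]; have : ((41 * n : ℕ) : ℤ) < ((p ^ 2 : ℕ) : ℤ) := by exact_mod_cast hsq
    push_cast at this; nlinarith
  have hwin' : (bRecord' n 0 + 2 : ℤ) < (p : ℤ) ^ 2 := by rw [h0', ← h0]; exact hwin
  have hhi' : 1 * p < 13 * n := lt_mul_of_prime hp hnp (show 13 < p by omega) (by norm_num) hn1 (by omega)
  -- `v_p(N♯)`
  have e12 : 12 * n / p = 0 := Nat.div_eq_of_lt_le (by omega) (by omega)
  have e13 : 13 * n / p = 1 := Nat.div_eq_of_lt_le (by omega) (by omega)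
  have e14 : 14 * n / p = 1 := Nat.div_eq_of_lt_le (by omega) (by omega)
  have e15 : 15 * n / p = 1 := Nat.div_eq_of_lt_le (by omega) (by omega)
  have e16 : 16 * n / p = 1 := Nat.div_eq_of_lt_le (by omega) (by omega)
  have hvN : padicValRat p (sharpNormaliser (bRecord n)) = 3 := by
    rw [padicValRat_sharpNormaliser_bRecord hp hsq16, e12, e13, e14, e15, e16]; norm_num
  have hvN' : padicValRat p (sharpNormaliser (bRecord' n)) = 3 := by
    rw [padicValRat_sharpNormaliser_bRecord' hn1 hp hnp (by omega) hsq16, e12, e13, e14, e15, e16]; norm_num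
  -- the law `lawW = refundW + a_p − N_p ≥ -5` at `b` and `b′`
  have htop : (6 : ℤ) ≤ topPartners (bRecord n) p := by
    have h := topPartners_bRecord_ge n p (Ico 0 7) (fun i hi => by simp only [mem_Ico] at hi; simp only [mem_range]; omega)
      (fun i hi => by
        simp only [mem_Ico] at hi
        obtain ⟨hi1, hi2⟩ := hi
        interval_cases i <;> simp only [h0, h1, h2, h3, h4, h5, h6, h7] <;> omega)
    simpa using h
  have htop' : (6 : ℤ) ≤ topPartners (bRecord' n) p := by
    have h := topPartners_bRecord'_ge hn1 p (Ico 0 7) (fun i hi => by simp only [mem_Ico] at hi; simp only [mem_range]; omega)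
      (fun i hi => by
        simp only [mem_Ico] at hi
        obtain ⟨hi1, hi2⟩ := hi
        interval_cases i <;> simp only [h0', h1', h2', h3', h4', h5', h6', h7'] <;> omega)
    simpa using h
  have hpf : pairFloors (bRecord n) p ≤ 12 := by
    refine (pairFloors_bRecord_le_pfLaw hp.pos (by omega)).trans ?_
    unfold pfLaw; split_ifs <;> omega
  have hpf' : pairFloors (bRecord' n) p ≤ 12 := by
    refine (pairFloors_bRecord'_le_pfLaw hp.pos (by omega)).trans ?_
    unfold pfLaw; split_ifs <;> omega
  have hLW : coeffW (bRecord n) ≠ 0 → (-5 : ℤ) ≤ padicValRat p (coeffW (bRecord n)) := fun hW => by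
    refine le_trans ?_ (zeta3CoefficientValuationLaw_window _ _ hP hp hp5 hwin hW)
    unfold lawW; rw [refundW_bRecord hp.pos (by omega)]; linarith
  have hLW' : coeffW (bRecord' n) ≠ 0 → (-5 : ℤ) ≤ padicValRat p (coeffW (bRecord' n)) := fun hW => by
    refine le_trans ?_ (zeta3CoefficientValuationLaw_window _ _ hP' hp hp5 hwin' hW)
    unfold lawW; rw [refundW_bRecord' hp.pos (by omega)]; linarith
  have dW : (p : ℤ) ^ 1 ∣ zW := dvd_zterm hp hp41 hsq hvN hLW hzW (by norm_num)
  have dW' : (p : ℤ) ^ 1 ∣ zW' := dvd_zterm hp hp41 hsq hvN' hLW' hzW' (by norm_num)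
  have dV : (p : ℤ) ^ 0 ∣ zV := by rw [pow_zero]; exact one_dvd _
  have dV' : (p : ℤ) ^ 0 ∣ zV' := by rw [pow_zero]; exact one_dvd _
  exact law_core (natCast_dvd_lcmUpto41 hp hp41) dW dW' dV dV' (by norm_num) (by norm_num) (by norm_num) (by norm_num)

/-- (WV)-law window `(13n, 14n]`: `v_p(N♯) = 1`, `a_p ≥ 5`, `N_p ≤ 9`, so `v_p(W) ≥ -3` (Theorem `(WV)` in the window),
`v_p(z_W) ≥ 1`; exponent `1`. -/
theorem wLaw1 {n p : ℕ} (hn : 42 ≤ n) (hp : p.Prime) (hlo : 13 * n < p) (hhi : p ≤ 14 * n)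
    {zW zV zW' zV' zU zU' : ℤ}
    (hzW : dRec n ^ 3 * sharpNormaliser (bRecord n) * coeffW (bRecord n) = zW)
    (_hzV : dRec n ^ 6 * sharpNormaliser (bRecord n) * coeffV (bRecord n) = zV)
    (hzW' : dRec n ^ 3 * sharpNormaliser (bRecord' n) * coeffW (bRecord' n) = zW')
    (_hzV' : dRec n ^ 6 * sharpNormaliser (bRecord' n) * coeffV (bRecord' n) = zV')
    (_hzU : dRec n * sharpNormaliser (bRecord n) * coeffU (bRecord n) = zU)
    (_hzU' : dRec n * sharpNormaliser (bRecord' n) * coeffU (bRecord' n) = zU') :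
    (p : ℤ) ^ 1 ∣ (zW' * zV - zW * zV') ∧
    (p : ℤ) ^ 1 ∣ ((Nat.lcmUpto (41 * n) : ℤ) ^ 5 * (zU * zW') - (Nat.lcmUpto (41 * n) : ℤ) ^ 5 * (zU' * zW)) := by
  haveI := Fact.mk hp
  obtain ⟨h0, h1, h2, h3, h4, h5, h6, h7⟩ := bRecord_vals n
  obtain ⟨h0', h1', h2', h3', h4', h5', h6', h7'⟩ := bRecord'_vals n
  have hn1 : 1 ≤ n := by omega
  have hnp : n < p := by omega
  have hp5 : 5 ≤ p := by omega
  have hp41 : p ≤ 41 * n := by omega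
  have hsq : 41 * n < p ^ 2 := by nlinarith
  have hsq16 : 16 * n < p ^ 2 := by nlinarith
  have hP := inPolytope_bRecord n
  have hP' := inPolytope_bRecord' hn1
  have hwin : (bRecord n 0 + 2 : ℤ) < (p : ℤ) ^ 2 := by
    rw [h0]; have : ((41 * n : ℕ) : ℤ) < ((p ^ 2 : ℕ) : ℤ) := by exact_mod_cast hsq
    push_cast at this; nlinarith
  have hwin' : (bRecord' n 0 + 2 : ℤ) < (p : ℤ) ^ 2 := by rw [h0', ← h0]; exact hwin
  have hhi' : 1 * p < 14 * n := lt_mul_of_prime hp hnp (show 14 < p by omega) (by norm_num) hn1 (by omega)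
  -- `v_p(N♯)`
  have e12 : 12 * n / p = 0 := Nat.div_eq_of_lt_le (by omega) (by omega)
  have e13 : 13 * n / p = 0 := Nat.div_eq_of_lt_le (by omega) (by omega)
  have e14 : 14 * n / p = 1 := Nat.div_eq_of_lt_le (by omega) (by omega)
  have e15 : 15 * n / p = 1 := Nat.div_eq_of_lt_le (by omega) (by omega)
  have e16 : 16 * n / p = 1 := Nat.div_eq_of_lt_le (by omega) (by omega)
  have hvN : padicValRat p (sharpNormaliser (bRecord n)) = 1 := by
    rw [padicValRat_sharpNormaliser_bRecord hp hsq16, e12, e13, e14, e15, e16]; norm_num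
  have hvN' : padicValRat p (sharpNormaliser (bRecord' n)) = 1 := by
    rw [padicValRat_sharpNormaliser_bRecord' hn1 hp hnp (by omega) hsq16, e12, e13, e14, e15, e16]; norm_num
  -- the law `lawW = refundW + a_p − N_p ≥ -3` at `b` and `b′`
  have htop : (5 : ℤ) ≤ topPartners (bRecord n) p := by
    have h := topPartners_bRecord_ge n p (Ico 1 7) (fun i hi => by simp only [mem_Ico] at hi; simp only [mem_range]; omega)
      (fun i hi => by
        simp only [mem_Ico] at hi
        obtain ⟨hi1, hi2⟩ := hi
        interval_cases i <;> simp only [h0, h2, h3, h4, h5, h6, h7] <;> omega)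
    simpa using h
  have htop' : (5 : ℤ) ≤ topPartners (bRecord' n) p := by
    have h := topPartners_bRecord'_ge hn1 p (Ico 1 7) (fun i hi => by simp only [mem_Ico] at hi; simp only [mem_range]; omega)
      (fun i hi => by
        simp only [mem_Ico] at hi
        obtain ⟨hi1, hi2⟩ := hi
        interval_cases i <;> simp only [h0', h2', h3', h4', h5', h6', h7'] <;> omega)
    simpa using h
  have hpf : pairFloors (bRecord n) p ≤ 9 := by
    refine (pairFloors_bRecord_le_pfLaw hp.pos (by omega)).trans ?_
    unfold pfLaw; split_ifs <;> omega
  have hpf' : pairFloors (bRecord' n) p ≤ 9 := by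
    refine (pairFloors_bRecord'_le_pfLaw hp.pos (by omega)).trans ?_
    unfold pfLaw; split_ifs <;> omega
  have hLW : coeffW (bRecord n) ≠ 0 → (-3 : ℤ) ≤ padicValRat p (coeffW (bRecord n)) := fun hW => by
    refine le_trans ?_ (zeta3CoefficientValuationLaw_window _ _ hP hp hp5 hwin hW)
    unfold lawW; rw [refundW_bRecord hp.pos (by omega)]; linarith
  have hLW' : coeffW (bRecord' n) ≠ 0 → (-3 : ℤ) ≤ padicValRat p (coeffW (bRecord' n)) := fun hW => by
    refine le_trans ?_ (zeta3CoefficientValuationLaw_window _ _ hP' hp hp5 hwin' hW)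
    unfold lawW; rw [refundW_bRecord' hp.pos (by omega)]; linarith
  have dW : (p : ℤ) ^ 1 ∣ zW := dvd_zterm hp hp41 hsq hvN hLW hzW (by norm_num)
  have dW' : (p : ℤ) ^ 1 ∣ zW' := dvd_zterm hp hp41 hsq hvN' hLW' hzW' (by norm_num)
  have dV : (p : ℤ) ^ 0 ∣ zV := by rw [pow_zero]; exact one_dvd _
  have dV' : (p : ℤ) ^ 0 ∣ zV' := by rw [pow_zero]; exact one_dvd _
  exact law_core (natCast_dvd_lcmUpto41 hp hp41) dW dW' dV dV' (by norm_num) (by norm_num) (by norm_num) (by norm_num)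

/-- (WV)-law window `(14n, 15n]`: `v_p(N♯) = -1`, `a_p ≥ 4`, `N_p ≤ 6`, so `v_p(W) ≥ -1` (Theorem `(WV)` in the window),
`v_p(z_W) ≥ 1`; exponent `1`. -/
theorem wLaw2 {n p : ℕ} (hn : 42 ≤ n) (hp : p.Prime) (hlo : 14 * n < p) (hhi : p ≤ 15 * n)
    {zW zV zW' zV' zU zU' : ℤ}
    (hzW : dRec n ^ 3 * sharpNormaliser (bRecord n) * coeffW (bRecord n) = zW)
    (_hzV : dRec n ^ 6 * sharpNormaliser (bRecord n) * coeffV (bRecord n) = zV)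
    (hzW' : dRec n ^ 3 * sharpNormaliser (bRecord' n) * coeffW (bRecord' n) = zW')
    (_hzV' : dRec n ^ 6 * sharpNormaliser (bRecord' n) * coeffV (bRecord' n) = zV')
    (_hzU : dRec n * sharpNormaliser (bRecord n) * coeffU (bRecord n) = zU)
    (_hzU' : dRec n * sharpNormaliser (bRecord' n) * coeffU (bRecord' n) = zU') :
    (p : ℤ) ^ 1 ∣ (zW' * zV - zW * zV') ∧
    (p : ℤ) ^ 1 ∣ ((Nat.lcmUpto (41 * n) : ℤ) ^ 5 * (zU * zW') - (Nat.lcmUpto (41 * n) : ℤ) ^ 5 * (zU' * zW)) := by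
  haveI := Fact.mk hp
  obtain ⟨h0, h1, h2, h3, h4, h5, h6, h7⟩ := bRecord_vals n
  obtain ⟨h0', h1', h2', h3', h4', h5', h6', h7'⟩ := bRecord'_vals n
  have hn1 : 1 ≤ n := by omega
  have hnp : n < p := by omega
  have hp5 : 5 ≤ p := by omega
  have hp41 : p ≤ 41 * n := by omega
  have hsq : 41 * n < p ^ 2 := by nlinarith
  have hsq16 : 16 * n < p ^ 2 := by nlinarith
  have hP := inPolytope_bRecord n
  have hP' := inPolytope_bRecord' hn1
  have hwin : (bRecord n 0 + 2 : ℤ) < (p : ℤ) ^ 2 := by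
    rw [h0]; have : ((41 * n : ℕ) : ℤ) < ((p ^ 2 : ℕ) : ℤ) := by exact_mod_cast hsq
    push_cast at this; nlinarith
  have hwin' : (bRecord' n 0 + 2 : ℤ) < (p : ℤ) ^ 2 := by rw [h0', ← h0]; exact hwin
  have hhi' : 1 * p < 15 * n := lt_mul_of_prime hp hnp (show 15 < p by omega) (by norm_num) hn1 (by omega)
  -- `v_p(N♯)`
  have e12 : 12 * n / p = 0 := Nat.div_eq_of_lt_le (by omega) (by omega)
  have e13 : 13 * n / p = 0 := Nat.div_eq_of_lt_le (by omega) (by omega)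
  have e14 : 14 * n / p = 0 := Nat.div_eq_of_lt_le (by omega) (by omega)
  have e15 : 15 * n / p = 1 := Nat.div_eq_of_lt_le (by omega) (by omega)
  have e16 : 16 * n / p = 1 := Nat.div_eq_of_lt_le (by omega) (by omega)
  have hvN : padicValRat p (sharpNormaliser (bRecord n)) = -1 := by
    rw [padicValRat_sharpNormaliser_bRecord hp hsq16, e12, e13, e14, e15, e16]; norm_num
  have hvN' : padicValRat p (sharpNormaliser (bRecord' n)) = -1 := by
    rw [padicValRat_sharpNormaliser_bRecord' hn1 hp hnp (by omega) hsq16, e12, e13, e14, e15, e16]; norm_num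
  -- the law `lawW = refundW + a_p − N_p ≥ -1` at `b` and `b′`
  have htop : (4 : ℤ) ≤ topPartners (bRecord n) p := by
    have h := topPartners_bRecord_ge n p (Ico 2 7) (fun i hi => by simp only [mem_Ico] at hi; simp only [mem_range]; omega)
      (fun i hi => by
        simp only [mem_Ico] at hi
        obtain ⟨hi1, hi2⟩ := hi
        interval_cases i <;> simp only [h0, h3, h4, h5, h6, h7] <;> omega)
    simpa using h
  have htop' : (4 : ℤ) ≤ topPartners (bRecord' n) p := by
    have h := topPartners_bRecord'_ge hn1 p (Ico 2 7) (fun i hi => by simp only [mem_Ico] at hi; simp only [mem_range]; omega)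
      (fun i hi => by
        simp only [mem_Ico] at hi
        obtain ⟨hi1, hi2⟩ := hi
        interval_cases i <;> simp only [h0', h3', h4', h5', h6', h7'] <;> omega)
    simpa using h
  have hpf : pairFloors (bRecord n) p ≤ 6 := by
    refine (pairFloors_bRecord_le_pfLaw hp.pos (by omega)).trans ?_
    unfold pfLaw; split_ifs <;> omega
  have hpf' : pairFloors (bRecord' n) p ≤ 6 := by
    refine (pairFloors_bRecord'_le_pfLaw hp.pos (by omega)).trans ?_
    unfold pfLaw; split_ifs <;> omega
  have hLW : coeffW (bRecord n) ≠ 0 → (-1 : ℤ) ≤ padicValRat p (coeffW (bRecord n)) := fun hW => by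
    refine le_trans ?_ (zeta3CoefficientValuationLaw_window _ _ hP hp hp5 hwin hW)
    unfold lawW; rw [refundW_bRecord hp.pos (by omega)]; linarith
  have hLW' : coeffW (bRecord' n) ≠ 0 → (-1 : ℤ) ≤ padicValRat p (coeffW (bRecord' n)) := fun hW => by
    refine le_trans ?_ (zeta3CoefficientValuationLaw_window _ _ hP' hp hp5 hwin' hW)
    unfold lawW; rw [refundW_bRecord' hp.pos (by omega)]; linarith
  have dW : (p : ℤ) ^ 1 ∣ zW := dvd_zterm hp hp41 hsq hvN hLW hzW (by norm_num)
  have dW' : (p : ℤ) ^ 1 ∣ zW' := dvd_zterm hp hp41 hsq hvN' hLW' hzW' (by norm_num)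
  have dV : (p : ℤ) ^ 0 ∣ zV := by rw [pow_zero]; exact one_dvd _
  have dV' : (p : ℤ) ^ 0 ∣ zV' := by rw [pow_zero]; exact one_dvd _
  exact law_core (natCast_dvd_lcmUpto41 hp hp41) dW dW' dV dV' (by norm_num) (by norm_num) (by norm_num) (by norm_num)

/-- (WV)-law window `(15n, 16n]`: `v_p(N♯) = -1`, `a_p ≥ 3`, `N_p ≤ 4`, so `v_p(W) ≥ 0` (Theorem `(WV)` in the window),
`v_p(z_W) ≥ 2`, `v_p(z_V) ≥ 1` (`(V)`-floor law); exponent `3`. -/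
theorem wLaw3 {n p : ℕ} (hn : 42 ≤ n) (hp : p.Prime) (hlo : 15 * n < p) (hhi : p ≤ 16 * n)
    {zW zV zW' zV' zU zU' : ℤ}
    (hzW : dRec n ^ 3 * sharpNormaliser (bRecord n) * coeffW (bRecord n) = zW)
    (hzV : dRec n ^ 6 * sharpNormaliser (bRecord n) * coeffV (bRecord n) = zV)
    (hzW' : dRec n ^ 3 * sharpNormaliser (bRecord' n) * coeffW (bRecord' n) = zW')
    (hzV' : dRec n ^ 6 * sharpNormaliser (bRecord' n) * coeffV (bRecord' n) = zV')
    (_hzU : dRec n * sharpNormaliser (bRecord n) * coeffU (bRecord n) = zU)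
    (_hzU' : dRec n * sharpNormaliser (bRecord' n) * coeffU (bRecord' n) = zU') :
    (p : ℤ) ^ 3 ∣ (zW' * zV - zW * zV') ∧
    (p : ℤ) ^ 3 ∣ ((Nat.lcmUpto (41 * n) : ℤ) ^ 5 * (zU * zW') - (Nat.lcmUpto (41 * n) : ℤ) ^ 5 * (zU' * zW)) := by
  haveI := Fact.mk hp
  obtain ⟨h0, h1, h2, h3, h4, h5, h6, h7⟩ := bRecord_vals n
  obtain ⟨h0', h1', h2', h3', h4', h5', h6', h7'⟩ := bRecord'_vals n
  have hn1 : 1 ≤ n := by omega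
  have hnp : n < p := by omega
  have hp5 : 5 ≤ p := by omega
  have hp41 : p ≤ 41 * n := by omega
  have hsq : 41 * n < p ^ 2 := by nlinarith
  have hsq16 : 16 * n < p ^ 2 := by nlinarith
  have hP := inPolytope_bRecord n
  have hP' := inPolytope_bRecord' hn1
  have hwin : (bRecord n 0 + 2 : ℤ) < (p : ℤ) ^ 2 := by
    rw [h0]; have : ((41 * n : ℕ) : ℤ) < ((p ^ 2 : ℕ) : ℤ) := by exact_mod_cast hsq
    push_cast at this; nlinarith
  have hwin' : (bRecord' n 0 + 2 : ℤ) < (p : ℤ) ^ 2 := by rw [h0', ← h0]; exact hwin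
  have hhi' : 1 * p < 16 * n := lt_mul_of_prime hp hnp (show 16 < p by omega) (by norm_num) hn1 (by omega)
  -- `v_p(N♯)`
  have e12 : 12 * n / p = 0 := Nat.div_eq_of_lt_le (by omega) (by omega)
  have e13 : 13 * n / p = 0 := Nat.div_eq_of_lt_le (by omega) (by omega)
  have e14 : 14 * n / p = 0 := Nat.div_eq_of_lt_le (by omega) (by omega)
  have e15 : 15 * n / p = 0 := Nat.div_eq_of_lt_le (by omega) (by omega)
  have e16 : 16 * n / p = 1 := Nat.div_eq_of_lt_le (by omega) (by omega)
  have hvN : padicValRat p (sharpNormaliser (bRecord n)) = -1 := by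
    rw [padicValRat_sharpNormaliser_bRecord hp hsq16, e12, e13, e14, e15, e16]; norm_num
  have hvN' : padicValRat p (sharpNormaliser (bRecord' n)) = -1 := by
    rw [padicValRat_sharpNormaliser_bRecord' hn1 hp hnp (by omega) hsq16, e12, e13, e14, e15, e16]; norm_num
  -- the law `lawW = refundW + a_p − N_p ≥ 0` at `b` and `b′`
  have htop : (3 : ℤ) ≤ topPartners (bRecord n) p := by
    have h := topPartners_bRecord_ge n p (Ico 3 7) (fun i hi => by simp only [mem_Ico] at hi; simp only [mem_range]; omega)
      (fun i hi => by
        simp only [mem_Ico] at hi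
        obtain ⟨hi1, hi2⟩ := hi
        interval_cases i <;> simp only [h0, h4, h5, h6, h7] <;> omega)
    simpa using h
  have htop' : (3 : ℤ) ≤ topPartners (bRecord' n) p := by
    have h := topPartners_bRecord'_ge hn1 p (Ico 3 7) (fun i hi => by simp only [mem_Ico] at hi; simp only [mem_range]; omega)
      (fun i hi => by
        simp only [mem_Ico] at hi
        obtain ⟨hi1, hi2⟩ := hi
        interval_cases i <;> simp only [h0', h4', h5', h6', h7'] <;> omega)
    simpa using h
  have hpf : pairFloors (bRecord n) p ≤ 4 := by
    refine (pairFloors_bRecord_le_pfLaw hp.pos (by omega)).trans ?_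
    unfold pfLaw; split_ifs <;> omega
  have hpf' : pairFloors (bRecord' n) p ≤ 4 := by
    refine (pairFloors_bRecord'_le_pfLaw hp.pos (by omega)).trans ?_
    unfold pfLaw; split_ifs <;> omega
  have hLW : coeffW (bRecord n) ≠ 0 → (0 : ℤ) ≤ padicValRat p (coeffW (bRecord n)) := fun hW => by
    refine le_trans ?_ (zeta3CoefficientValuationLaw_window _ _ hP hp hp5 hwin hW)
    unfold lawW; rw [refundW_bRecord hp.pos (by omega)]; linarith
  have hLW' : coeffW (bRecord' n) ≠ 0 → (0 : ℤ) ≤ padicValRat p (coeffW (bRecord' n)) := fun hW => by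
    refine le_trans ?_ (zeta3CoefficientValuationLaw_window _ _ hP' hp hp5 hwin' hW)
    unfold lawW; rw [refundW_bRecord' hp.pos (by omega)]; linarith
  have dW : (p : ℤ) ^ 2 ∣ zW := dvd_zterm hp hp41 hsq hvN hLW hzW (by norm_num)
  have dW' : (p : ℤ) ^ 2 ∣ zW' := dvd_zterm hp hp41 hsq hvN' hLW' hzW' (by norm_num)
  have hLV : coeffV (bRecord n) ≠ 0 → (-4 : ℤ) ≤ padicValRat p (coeffV (bRecord n)) := fun hV =>
    le_trans (by linarith [hpf]) (constantTermFloorLaw_window _ _ hP hp hp5 hwin hV)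
  have hLV' : coeffV (bRecord' n) ≠ 0 → (-4 : ℤ) ≤ padicValRat p (coeffV (bRecord' n)) := fun hV =>
    le_trans (by linarith [hpf']) (constantTermFloorLaw_window _ _ hP' hp hp5 hwin' hV)
  have dV : (p : ℤ) ^ 1 ∣ zV := dvd_zterm hp hp41 hsq hvN hLV hzV (by norm_num)
  have dV' : (p : ℤ) ^ 1 ∣ zV' := dvd_zterm hp hp41 hsq hvN' hLV' hzV' (by norm_num)
  exact law_core (natCast_dvd_lcmUpto41 hp hp41) dW dW' dV dV' (by norm_num) (by norm_num) (by norm_num) (by norm_num)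

end Windows

end Summit.KontsevichZagierPeriods.Zeta5Search.RecordRay
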